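import Literature.AlgebraicGeometry.HodgeTheory.ComplexGysin
import Literature.AlgebraicGeometry.HodgeTheory.TopDegreeClasses
import Literature.AlgebraicGeometry.HodgeTheory.RationalLattice
import Literature.AlgebraicTopology.SingularHomology.HomologyRingChange
import Literature.AlgebraicTopology.SingularHomology.FundamentalClassExistence
import HarnessLib

/-!
# The Gysin morphisms `complexGysin μ` on rational classes are the rational Gysin morphisms,
# up to the orientation scalar

Companion to `ComplexGysin` (the Gysin morphism `complexGysin μ hY hX f : Hᵃ(Y(ℂ); ℂ) → Hᵇ(X(ℂ); ℂ)`
of a morphism `f : Y ⟶ X` of smooth projective complex varieties relative to a family `μ` of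
`ℂ`-orientations; Fulton, *Young Tableaux*, App. B §B.1 (5): `f_* = PD⁻¹ ∘ f(ℂ)_* ∘ PD`) and to
`ComplexGysinOrientation` (dependence on `μ` only up to non-zero scalars). Here the comparison
with RATIONAL coefficients: for `ℚ`-orientations `ν_Y`, `ν_X` of `Y(ℂ)`, `X(ℂ)` (they exist:
`Motives.ComplexPoints.isOrientableOver`) with Poincaré duality for `ν_X`, the rational Gysin
homomorphism `gysinMap ν_Y ν_X f(ℂ) : Hᵃ(Y(ℂ); ℚ) → Hᵇ(X(ℂ); ℚ)` of the tree
(`AlgebraicTopology/SingularHomology/GysinMap`) satisfies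

  `complexGysin μ hY hX f (ι y) = u • ι (gysinMap ν_Y ν_X f(ℂ) y)`,  `u ∈ ℂ`, `u ≠ 0`,

for every `y ∈ Hᵃ(Y(ℂ); ℚ)`, where `ι = singularCohomology.ringChange (ℚ ↪ ℂ)`
(`complexGysin_ringChange_eq_smul_gysinMap`). In particular `complexGysin μ` maps rational classes
to `u •` rational classes — the form in which the Gysin morphism "is induced by
`f(ℂ)_* : H_*(Y(ℂ); ℤ) → H_*(X(ℂ); ℤ)` through Poincaré duality" (Voisin, *Hodge Theory I*, §7.3.2;
the hypothesis field `isRationalClass_gysin` of `GysinFormalism.IsHodgeCompatible`) holds for an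
ARBITRARY `ℂ`-orientation family. Proof (all PROVED here, on the tree's carriers): `X(ℂ)` is a
closed connected `2n`-manifold (SGA1 XII 2.4, `connectedSpace_complexPoints`), so `H_{2n}(X(ℂ); ℂ)`
is the line spanned by `[X(ℂ)]_μ` (Hatcher Thm. 3.26; `exists_eq_smul_fundamentalClass_of_connectedSpace`,
the general form of `HyperplaneSectionMonodromyProofs.exists_eq_smul_fundamentalClass`); hence
the image `ι_*[X(ℂ)]_{ν}` of the rational fundamental class under the change of coefficients
`ℚ → ℂ` in homology (`AlgebraicTopology/SingularHomology/HomologyRingChange`, injective) is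
`λ_X • [X(ℂ)]_μ` with `λ_X ≠ 0`; the defining squares `f_* y ⌢ [X] = f(ℂ)_* (y ⌢ [Y])` over `ℚ`
and over `ℂ` (`capProduct_gysinMap`, `capProduct_complexGysin`), the compatibility of `ι` with cap
products and push-forwards (`coeffChange_capProduct`, `coeffChange_map`) and the injectivity of
`⌢ [X(ℂ)]_μ` (Poincaré duality for `μ`) give the claim with `u = λ_X λ_Y⁻¹`.

## References

* [FultonYoungTableaux1997] W. Fulton, Young Tableaux, CUP 1997, App. B §B.1 (4)–(5).
* [VoisinHodgeI2002] C. Voisin, Hodge Theory and Complex Algebraic Geometry I, CUP 2002, §7.3.2.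
* [HatcherAT2002] A. Hatcher, Algebraic Topology, CUP 2002, §2.2 p. 165, §3.3 Thm. 3.26, 3.30.
* [SGA1] A. Grothendieck, M. Raynaud, SGA 1, Exp. XII Prop. 2.4.
-/

noncomputable section

open CategoryTheory AlgebraicGeometry
open Literature.AlgebraicTopology.SingularHomology

namespace Literature.AlgebraicGeometry.HodgeTheory

section HodgeTheory

universe u v

/-! ### Top homology of a closed connected oriented manifold is the line of the fundamental class -/

/-- **`Hₙ(M; R) = R · [M]_μ` for a closed connected `R`-oriented `n`-manifold**: every class
`z ∈ Hₙ(M; R)` is `c • [M]_μ` with `c = e(z|ₓ₀)` for an identification `e : Hₙ(M | x₀; R) ≃ R`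
sending `μ_{x₀}` to `1` (Hatcher Thm. 3.26(a)–(b): `Hₙ(M; R) → Hₙ(M | x; R) ≅ R` is injective and
`[M]_μ ↦ μ_x`). [cite: HatcherAT2002, §3.3 Thm. 3.26] -/
theorem exists_eq_smul_fundamentalClass_of_connectedSpace {M : Type u} [TopologicalSpace M] [CompactSpace M]
    [T2Space M] {d : ℕ} [ChartedSpace (EuclideanSpace ℝ (Fin d)) M] [ConnectedSpace M]
    {R : Type v} [CommRing R] (μ : HomologicalOrientation R M d) (z : singularHomology R R M d) :
    ∃ c : R, z = c • μ.fundamentalClass := by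
  obtain ⟨x₀⟩ := (inferInstance : Nonempty M)
  obtain ⟨e, he⟩ := μ.isGenerator x₀
  have hμ := HomologicalOrientation.isFundamentalClass_fundamentalClass_holds (R := R) (X := M) d μ
  refine ⟨e (singularHomology.toLocal R R x₀ d z), ?_⟩
  apply singularHomology.toLocal_injective_of_connectedSpace_holds R R M d x₀
  rw [map_smul, hμ x₀]
  apply e.injective
  rw [map_smul, he, smul_eq_mul, mul_one]

/-- The fundamental class of an `R`-orientation of a non-empty space is non-zero (it restricts to
a generator of `Hₙ(M | x; R) ≅ R` at any point, Hatcher Thm. 3.26(a)), provided it is a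
fundamental class (closed manifolds). [cite: HatcherAT2002, §3.3 Thm. 3.26] -/
theorem fundamentalClass_ne_zero {M : Type u} [TopologicalSpace M] [CompactSpace M] [T2Space M]
    {d : ℕ} [ChartedSpace (EuclideanSpace ℝ (Fin d)) M] [Nonempty M] {R : Type v} [CommRing R]
    [Nontrivial R] (μ : HomologicalOrientation R M d) : μ.fundamentalClass ≠ 0 := by
  obtain ⟨x₀⟩ := (inferInstance : Nonempty M)
  obtain ⟨e, he⟩ := μ.isGenerator x₀
  have hμ := HomologicalOrientation.isFundamentalClass_fundamentalClass_holds (R := R) (X := M) d μ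
  intro h0
  apply one_ne_zero (α := R)
  rw [← he, ← hμ x₀, h0, map_zero, map_zero]

/-! ### The change of coefficients `ℚ → ℂ` in homology is injective -/

/-- **`Hₖ(T; ℚ) → Hₖ(T; ℂ)` is injective** for every space `T` (the change of coefficients along
`ℚ ↪ ℂ` has the additive left inverse induced by a `ℚ`-linear retraction `ℂ → ℚ`,
`singularHomology.coeffChange_injective_of_leftInverse`; Hatcher §2.2 p. 165).
[cite: HatcherAT2002, §2.2 p. 165] -/
theorem coeffChange_rat_injective (T : Type) [TopologicalSpace T] (k : ℕ) :
    Function.Injective (singularHomology.coeffChange T (algebraMap ℚ ℂ).toAddMonoidHom k) := by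
  refine singularHomology.coeffChange_injective_of_leftInverse _ ratRetraction.toAddMonoidHom ?_ k
  ext q
  change ratRetraction (algebraMap ℚ ℂ q) = q
  rw [eq_ratCast]
  exact ratRetraction_ratCast q

variable {μ : OrientationFamily} {m n : ℕ} {Y X : Motives.SchemeOver ℂ}

/-- **The complexified rational fundamental class is a non-zero multiple of `[X(ℂ)]_μ`**: for `X`
smooth projective of dimension `n`, a `ℚ`-orientation `ν` and a `ℂ`-orientation `μ_X` of `X(ℂ)`,
`ι_* [X(ℂ)]_ν = c • [X(ℂ)]_{μ_X}` in `H_{2n}(X(ℂ); ℂ)` with `c ≠ 0` (`X(ℂ)` is a closed connected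
manifold: `exists_eq_smul_fundamentalClass_of_connectedSpace`; `c ≠ 0` because `ι_*` is injective and `[X(ℂ)]_ν ≠ 0`).
[cite: HatcherAT2002, §3.3 Thm. 3.26] [cite: SGA1, Exp. XII Prop. 2.4] -/
theorem exists_coeffChange_fundamentalClass_eq_smul (μ : OrientationFamily)
    (hX : Motives.IsSmoothProjective n X)
    (ν : HomologicalOrientation ℚ (Motives.ComplexPoints X) (2 * n)) :
    ∃ c : ℂ, c ≠ 0 ∧
      singularHomology.coeffChange (Motives.ComplexPoints X) (algebraMap ℚ ℂ).toAddMonoidHom (2 * n)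
          ν.fundamentalClass = c • (μ hX).fundamentalClass := by
  letI := hX.chartedSpace
  haveI := Motives.ComplexPoints.compactSpace_of_isSmoothProjective hX
  haveI := Motives.ComplexPoints.t2Space_of_isSmoothProjective hX
  haveI := connectedSpace_complexPoints hX
  obtain ⟨c, hc⟩ := exists_eq_smul_fundamentalClass_of_connectedSpace (μ hX)
    (singularHomology.coeffChange (Motives.ComplexPoints X) (algebraMap ℚ ℂ).toAddMonoidHom (2 * n)
      ν.fundamentalClass)
  refine ⟨c, ?_, hc⟩
  rintro rfl
  rw [zero_smul, ← map_zero (singularHomology.coeffChange (Motives.ComplexPoints X)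
    (algebraMap ℚ ℂ).toAddMonoidHom (2 * n))] at hc
  exact fundamentalClass_ne_zero ν (coeffChange_rat_injective _ _ hc)

/-- **`complexGysin μ` on rational classes is the rational Gysin morphism, up to the orientation
scalar.** Let `f : Y ⟶ X` be a morphism of smooth projective varieties of dimensions `m`, `n`, `μ`
an orientation family with Poincaré duality, `ν_Y`, `ν_X` `ℚ`-orientations of `Y(ℂ)`, `X(ℂ)` with
Poincaré duality for `ν_X`, and `a + q = 2m`, `b + q = 2n`. Then there is `u ∈ ℂ`, `u ≠ 0`, with
`complexGysin μ hY hX f (ι y) = u • ι (gysinMap ν_Y ν_X f(ℂ) y)` for all `y ∈ Hᵃ(Y(ℂ); ℚ)`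
(`ι = singularCohomology.ringChange (ℚ ↪ ℂ)`): both `f_*`'s are `PD⁻¹ ∘ f(ℂ)_* ∘ PD` (Fulton
App. B (5)), the changes of coefficients commute with cap products and push-forwards, and the
complexified rational fundamental classes are `λ • [–(ℂ)]_μ`, `λ ≠ 0`; `u = λ_X λ_Y⁻¹`.
[cite: FultonYoungTableaux1997, Appendix B §B.1 (5)] [cite: VoisinHodgeI2002, §7.3.2]
[cite: HatcherAT2002, §3.3 Thm. 3.26 and Thm. 3.30] -/
theorem complexGysin_ringChange_eq_smul_gysinMap (hμ : μ.HasPoincareDuality)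
    (hY : Motives.IsSmoothProjective m Y) (hX : Motives.IsSmoothProjective n X) (f : Y ⟶ X)
    {a b q : ℕ} (ha : a + q = 2 * m) (hb : b + q = 2 * n)
    (νY : HomologicalOrientation ℚ (Motives.ComplexPoints Y) (2 * m))
    (νX : HomologicalOrientation ℚ (Motives.ComplexPoints X) (2 * n)) (hνX : νX.HasPoincareDuality) :
    ∃ u : ℂ, u ≠ 0 ∧ ∀ y : singularCohomology ℚ ℚ (Motives.ComplexPoints Y) a,
      complexGysin μ hY hX f (show a + 2 * n = b + 2 * m by omega)
          (singularCohomology.ringChange (algebraMap ℚ ℂ) (Motives.ComplexPoints Y) a y) =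
        u • singularCohomology.ringChange (algebraMap ℚ ℂ) (Motives.ComplexPoints X) b
          (gysinMap νY νX (Motives.AlgPoints.mapContinuous (L := ℂ) f) ha hb y) := by
  obtain ⟨cX, hcX0, hcX⟩ := exists_coeffChange_fundamentalClass_eq_smul μ hX νX
  obtain ⟨cY, hcY0, hcY⟩ := exists_coeffChange_fundamentalClass_eq_smul μ hY νY
  refine ⟨cX * cY⁻¹, mul_ne_zero hcX0 (inv_ne_zero hcY0), fun y ↦ ?_⟩
  -- the two defining squares, read through the changes of coefficients
  have e1 : capProduct hb (singularCohomology.ringChange (algebraMap ℚ ℂ) (Motives.ComplexPoints X) b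
        (gysinMap νY νX (Motives.AlgPoints.mapContinuous (L := ℂ) f) ha hb y))
      (singularHomology.coeffChange (Motives.ComplexPoints X) (algebraMap ℚ ℂ).toAddMonoidHom (2 * n)
        νX.fundamentalClass) =
      singularHomology.map ℂ ℂ (Motives.AlgPoints.mapContinuous (L := ℂ) f) q
        (capProduct ha (singularCohomology.ringChange (algebraMap ℚ ℂ) (Motives.ComplexPoints Y) a y)
          (singularHomology.coeffChange (Motives.ComplexPoints Y) (algebraMap ℚ ℂ).toAddMonoidHom
            (2 * m) νY.fundamentalClass)) := by
    rw [← singularHomology.coeffChange_capProduct, capProduct_gysinMap hνX _ ha hb y,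
      singularHomology.coeffChange_map, singularHomology.coeffChange_capProduct]
  rw [hcX, hcY, map_smul, map_smul, map_smul] at e1
  -- `e1 : cX • (ι(f_! y) ⌢ [X]_μ) = cY • f_* (ι y ⌢ [Y]_μ)`
  apply (hμ hX hb).1
  rw [poincareDualityMap_apply, poincareDualityMap_apply, capProduct_complexGysin hμ hY hX f _ ha hb,
    map_smul, LinearMap.smul_apply]
  have e2 := congrArg (fun w ↦ cY⁻¹ • w) e1
  simp only [smul_smul, inv_mul_cancel₀ hcY0, one_smul] at e2
  rw [← e2, mul_comm]

end HodgeTheory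

end Literature.AlgebraicGeometry.HodgeTheory

end
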